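import Summits.Ventures.LatticeQCDFlow.Scaling.DominatedStarRegimeFreeRelaxation
import Literature.Probability.MarkovChains.RelaxationTimeVarianceDecay
import Literature.Probability.MarkovChains.LogSobolevProductChains
import Literature.Probability.MarkovChains.LogSobolevPiChain

/-!
HONEST FRAMING: exact (Metropolis-corrected) sampling algorithms for lattice gauge theory; figures
of merit are autocorrelation/cost numbers at stated couplings and volumes; no continuum-physics
claim.

# DominatedStarRegimeFreeLogSobolev — `log K` INSTEAD OF `K` IN THE REGIME-FREE MIXING TIME, BY THE LOGARITHMIC SOBOLEV CONSTANT: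
# THE ROTATION PATHS COMPARE THE HUB WITH THE PRODUCT OF EXACT REDRAWS (`α ≥ min_k α(μ_k)/(K+1)`), SO `α(P) ≥ G'·α₀` AND, THE EXACT
# HOT DRAW BEING A PROJECTION, `α(P²) ≥ h·α(P)`; HENCE **`t_mix(ε) ≤ ⌈(log log(1/π̃_min) + log(1/(2ε²)))/(h·G'·α₀)⌉`** WITH
# `G' = p·min{ct/(3m), h/(7K)}`, `h = (1−t)w_0`, `α₀ ≤ α(μ_k-chain)` (`≥ (1−2μ_{k,*})/log((1−μ_{k,*})/μ_{k,*})`) — THE NUMBER OF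
# LEVELS ENTERS THROUGH `log log(1/π̃_min) ≈ log((K+1)·L)` ONLY; NO REGIME (lean-2 GEN-28, ours)

Venture-side (OURS).  Cell `lqcd-flow` (pub-lqcd), unit `pub-lqcd-lean-2-g28`, 2026-08-28.  Chapter N, file 13.  N4's mixing ceiling
`⌈G⁻¹·log(1/(2ε π̃_min))⌉` carries the whole configuration-space volume `log(1/π̃_min) = Σ_k log(1/min μ_k)` — linear in the
number of levels.  The hypercontractive route (Miclo's discrete-time entropy decay, in the tree: `Miclo1997_mixingTime_le`,
`t_mix(ε) ≤ ⌈(log log(1/π_min) + log(1/(2ε²)))/α(PP̃)⌉`) needs the log-Sobolev constant of `PP̃ = P²` (the scheme is reversible).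
Two comparisons give it: (i) the rotation-path inequality of N1/N2 IS a Dirichlet-form comparison `𝓔_{Π*} ≤ 𝓔_P/((K+1)G')` with the
product `Π*` of exact redraws at uniform weights, whose log-Sobolev constant is `min_k α(μ_k)/(K+1)` (Saloff-Coste Lemma 2.2.11, in the
tree), so `α(P) ≥ G'·min_k α(μ_k)` (Lemma 2.2.12); (ii) every eigenvalue of `P` is `≥ −1 + h` (N4), so `𝓔_{P²} ≥ h·𝓔_P` on the
eigenbasis and `α(P²) ≥ h·α(P)`.  For the one-level exact-redraw chain `α(μ_k) = (1 − 2μ_{k,*})/log((1−μ_{k,*})/μ_{k,*})` (Theorem 2.2.9 /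
Corollary 2.2.10, in the tree), of order `1/log(1/μ_{k,*})`: ONE level's volume, not the ladder's.

## What is proved

* §0 (any reversible chain) `piInner_kernelAt_eq_sum_spec` (`⟨f, Pᵗf⟩_π = Σ_j λ_jᵗ⟨f,f_j⟩²`), `dirichletForm_kernelAt_eq_sum_spec`
  (`𝓔_{Pᵗ}(f) = Σ_j (1 − λ_jᵗ)⟨f,f_j⟩²`), **`dirichletForm_le_inv_mul_dirichletForm_sq`** (`𝓔_P ≤ (2−h)‖·‖² ⇒ 𝓔_P(f) ≤ h⁻¹·𝓔_{P²}(f)`),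
  **`logSobolevConst_sq_ge`** (`α(P·P̃) ≥ h·α(P)` for reversible `P`).
* §1 (the scheme) **`dominatedStar_exactProduct_dirichletForm_le`** — `𝓔_{Π*}(f) ≤ 𝓔_P(f)/((K+1)·G')`, `Π*` the uniform-weight
  product of exact redraws; **`dominatedStar_logSobolevConst_ge`** — `α(P) ≥ G'·α₀` whenever `α₀ ≤ α(μ_k, E_k)` for all `k`;
  `dominatedStar_logSobolevConst_sq_ge` — `α(PP̃) ≥ h·G'·α₀`.
* §2 **`dominatedStar_mixingTime_le_logSobolev`** — exact hot sampler, one-sided domination, reversible cold kernels, multiplicities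
  `≥ c ≥ 1`, `0 < t < 1`, `w_0 > 0`, `K ≥ 1`, `|S| ≥ 2`, `0 < α₀ ≤ α(μ_k, E_k)` for all `k`, `0 < π̃_min ≤ π̃`, `π̃_min < 1`:
  **`t_mix(ε) ≤ ⌈(log log(1/π̃_min) + log(1/(2ε²)))/(h·G'·α₀)⌉`**; `exactRedraw_logSobolevConst_ge` — the admissible
  `α₀ = min_k (1 − 2μ_{k,*})/log((1−μ_{k,*})/μ_{k,*})`.

Reading (no numerics implied): with hot-only half swaps (`h = ½`) and uniform listing the cold-start mixing time of the exact-sampler hub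
is at most order `(K/p)·L·log((K+1)L/ε²)` with `L` the largest single-level `log(1/μ_{k,*})`, against N4's `(K/p)·(K+1)·L`: OPEN-MATH
item 1's `K ↦ log K` is achieved up to ONE level's volume factor.  NOT CLAIMED: removal of `L` (that is item 1 proper; chapter M has it
inside the regime); the factor `1/h` is the price of discrete time (period-two modes) and is `2` at half swaps with hot-only updates;
anything measured.  Literature grade (cell rule): OWN COMPOSITION on N1/N2/N4 and the tree's Saloff-Coste Lemmas 2.2.11–2.2.12,
Theorem 2.2.9/Cor. 2.2.10 and Miclo's discrete-time bound; nothing cited as a fact; no new bib keys.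
-/

noncomputable section

open Finset Function Matrix
open Literature.Probability.MarkovChains

namespace Summit.Ventures.LatticeQCDFlow.Scaling

/-! ## §0 `𝓔_{P²} ≥ h·𝓔_P` and `α(P²) ≥ h·α(P)` when the spectrum lies in `[−1 + h, 1]` -/

section Generic
variable {X : Type*} [Fintype X] [DecidableEq X] {π : X → ℝ} {P : Matrix X X ℝ}

/-- `⟨f, Pᵗf⟩_π = Σ_j λ_jᵗ·⟨f,f_j⟩²_π` on the real eigenbasis of a reversible `P`. [ours] -/
theorem piInner_kernelAt_eq_sum_spec (hπ : ∀ x, 0 < π x) (hA : (symmMatrix π P).IsHermitian) (f : X → ℝ) (t : ℕ) :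
    piInner π f (fun x => ∑ y, kernelAt P t x y * f y) = ∑ j, specVal hA j ^ t * piInner π f (specFun hA j) ^ 2 := by
  set c : X → ℝ := fun j => piInner π f (specFun hA j) with hc
  have hexp : (fun x => ∑ y, kernelAt P t x y * f y) = fun x => ∑ j, (c j * specVal hA j ^ t) * specFun hA j x := by
    funext x
    simp only [hc, LevinPeres2017_eq_12_5 hπ hA f t x]
  have hf : f = fun x => ∑ j, c j * specFun hA j x := funext fun x => (sum_piInner_specFun_mul hπ hA f x).symm
  have hlhs : piInner π f (fun x => ∑ j, (c j * specVal hA j ^ t) * specFun hA j x)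
      = piInner π (fun x => ∑ j, c j * specFun hA j x) (fun x => ∑ j, (c j * specVal hA j ^ t) * specFun hA j x) := by
    rw [← hf]
  rw [hexp, hlhs, piInner_sum_mul_specFun hπ hA univ c (fun j => c j * specVal hA j ^ t)]
  exact sum_congr rfl fun j _ => by ring

/-- `𝓔_{Pᵗ}(f) = Σ_j (1 − λ_jᵗ)·⟨f,f_j⟩²_π` for a reversible `P` (positive `π`). [ours] -/
theorem dirichletForm_kernelAt_eq_sum_spec (hπ : ∀ x, 0 < π x) (hP : IsRowStochastic P) (hDB : DetailedBalance π P)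
    (hA : (symmMatrix π P).IsHermitian) (f : X → ℝ) (t : ℕ) :
    dirichletForm π (kernelAt P t) f = ∑ j, (1 - specVal hA j ^ t) * piInner π f (specFun hA j) ^ 2 := by
  have hst : IsStationary π P := hDB.isStationary hP.2
  have hstt : IsStationary π (kernelAt P t) := fun y => congrFun (stepLaw_kernelAt_eq_self_of_isStationary hst t) y
  rw [dirichletForm_eq (kernelAt_isRowStochastic hP t) hstt f]
  have hmv : (kernelAt P t) *ᵥ f = fun x => ∑ y, kernelAt P t x y * f y := by
    funext x; rfl
  rw [hmv, piInner_kernelAt_eq_sum_spec hπ hA f t]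
  -- `⟨f,f⟩ = Σ_j ⟨f,f_j⟩²` (Parseval, `t = 0` of the previous identity)
  have h0 := piInner_kernelAt_eq_sum_spec hπ hA f 0
  have hid : (fun x => ∑ y, kernelAt P 0 x y * f y) = f := by
    funext x
    simp only [kernelAt_eq_pow_apply, pow_zero, Matrix.one_apply, ite_mul, one_mul, zero_mul, Finset.sum_ite_eq,
      Finset.mem_univ, if_true]
  rw [hid] at h0
  simp only [pow_zero, one_mul] at h0
  rw [h0, ← sum_sub_distrib]
  exact sum_congr rfl fun j _ => by ring

/-- **`𝓔_P ≤ (2 − h)‖·‖²_π ⇒ 𝓔_P(f) ≤ h⁻¹·𝓔_{P²}(f)`** for a reversible `P` (`π > 0`, `h > 0`): on the eigenbasis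
`1 − λ² = (1 − λ)(1 + λ) ≥ h(1 − λ)` because every eigenvalue is `≥ h − 1`. [ours] -/
theorem dirichletForm_le_inv_mul_dirichletForm_sq (hπ : ∀ x, 0 < π x) (hP : IsRowStochastic P) (hDB : DetailedBalance π P)
    {h : ℝ} (hh : 0 < h) (hE : ∀ f : X → ℝ, dirichletForm π P f ≤ (2 - h) * piInner π f f) (f : X → ℝ) :
    dirichletForm π P f ≤ 1 / h * dirichletForm π (kernelAt P 2) f := by
  have hA := symmMatrix_isHermitian hπ hDB
  have hst : IsStationary π P := hDB.isStationary hP.2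
  -- `𝓔_P = 𝓔_{P¹}`
  have h1 : dirichletForm π P f = dirichletForm π (kernelAt P 1) f := by
    have e : (kernelAt P 1 : Matrix X X ℝ) = P := by
      funext x y; rw [kernelAt_eq_pow_apply, pow_one]
    rw [e]
  rw [h1, dirichletForm_kernelAt_eq_sum_spec hπ hP hDB hA f 1, dirichletForm_kernelAt_eq_sum_spec hπ hP hDB hA f 2, mul_sum]
  refine sum_le_sum fun j _ => ?_
  -- the eigenvalue bounds `h − 1 ≤ λ_j ≤ 1`
  have hEj := hE (specFun hA j)
  rw [dirichletForm_eq_of_eigen hP hst (mulVec_specFun hπ hA j), piInner_specFun hπ hA j j, if_pos rfl] at hEj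
  have hlow : h - 1 ≤ specVal hA j := by linarith
  have hup : specVal hA j ≤ 1 := by
    have h0 := dirichletForm_nonneg (fun x => (hπ x).le) hP.1 (specFun hA j)
    rw [dirichletForm_eq_of_eigen hP hst (mulVec_specFun hπ hA j), piInner_specFun hπ hA j j, if_pos rfl] at h0
    linarith
  have hc : 0 ≤ piInner π f (specFun hA j) ^ 2 := sq_nonneg _
  -- `(1 − λ) ≤ h⁻¹ (1 − λ²)`
  have key : (1 - specVal hA j ^ 1) ≤ 1 / h * (1 - specVal hA j ^ 2) := by
    have hprod : h * (1 - specVal hA j) ≤ 1 - specVal hA j ^ 2 := by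
      nlinarith [mul_nonneg (sub_nonneg.mpr hup) (by linarith : (0 : ℝ) ≤ 1 + specVal hA j - h)]
    rw [pow_one]
    calc 1 - specVal hA j = (h * (1 - specVal hA j)) / h := by field_simp
      _ ≤ (1 - specVal hA j ^ 2) / h := div_le_div_of_nonneg_right hprod hh.le
      _ = 1 / h * (1 - specVal hA j ^ 2) := by ring
  calc (1 - specVal hA j ^ 1) * piInner π f (specFun hA j) ^ 2
      ≤ (1 / h * (1 - specVal hA j ^ 2)) * piInner π f (specFun hA j) ^ 2 := mul_le_mul_of_nonneg_right key hc
    _ = 1 / h * ((1 - specVal hA j ^ 2) * piInner π f (specFun hA j) ^ 2) := by ring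

/-- For a reversible `P`, `PP̃ = P²` is the two-step kernel. [ours] -/
theorem mulReversibilization_eq_kernelAt_two (hπ : ∀ x, 0 < π x) (hDB : DetailedBalance π P) :
    mulReversibilization π P = kernelAt P 2 := by
  unfold mulReversibilization
  rw [timeReversal_eq_self_of_detailedBalance (fun x => (hπ x).ne') hDB]
  funext x y
  rw [kernelAt_eq_pow_apply, pow_two]

/-- **`α(PP̃) ≥ h·α(P)`** for a reversible `P` with `𝓔_P ≤ (2−h)‖·‖²_π` (`π > 0` a probability vector, `h > 0`, `|X| ≥ 2`). [ours] -/
theorem logSobolevConst_sq_ge [Nontrivial X] (hπ : ∀ x, 0 < π x) (hπ1 : ∑ x, π x = 1) (hP : IsRowStochastic P)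
    (hDB : DetailedBalance π P) {h : ℝ} (hh : 0 < h) (hE : ∀ f : X → ℝ, dirichletForm π P f ≤ (2 - h) * piInner π f f) :
    h * logSobolevConst π P ≤ logSobolevConst π (mulReversibilization π P) := by
  rw [mulReversibilization_eq_kernelAt_two hπ hDB]
  have hcomp := Saloffcoste1997_lemma_2_2_12_logSobolev_same hπ hπ1 hπ hπ1 (kernelAt P 2 : Matrix X X ℝ) (K' := P) hP.1
    (A := 1 / h) (a := 1) (by positivity) zero_le_one
    (fun f => dirichletForm_le_inv_mul_dirichletForm_sq hπ hP hDB hh hE f) (fun x => by rw [one_mul])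
  rw [one_mul, div_div_eq_mul_div, div_one, mul_comm] at hcomp
  exact hcomp

end Generic

variable {S : Type*} [Fintype S] [DecidableEq S] {K m : ℕ} {μ : Fin (K + 1) → S → ℝ} {M : Fin (K + 1) → S → S → ℝ}
  {w : Fin (K + 1) → ℝ} {t p : ℝ}

section EntryStar
variable (κ : Fin m → Fin K) (φ : Fin m → Equiv.Perm S)

/-! ## §1 The rotation paths as a comparison with the product of exact redraws -/

/-- **`𝓔_{Π*}(f) ≤ 𝓔_P(f)/((K+1)·G')`** where `Π* = prodKernel (1/(K+1)) E` is the uniform-weight product of the exact redraws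
`E_k(u,·) = μ_k` and `G'` is any constant with `G'·3m ≤ pct`, `G'(p + 6K) ≤ pγ₀(1−t)w_0` (hot update with Poincaré constant `γ₀`,
one-sided domination, multiplicities `≥ c ≥ 1`, `0 < t < 1`, `w ≥ 0`, `w_0 > 0`; cold updates arbitrary transition matrices). [ours] -/
theorem dominatedStar_exactProduct_dirichletForm_le (hm : 1 ≤ m) (hμ : ∀ k x, 0 < μ k x) (hμ1 : ∀ k, ∑ u, μ k u = 1)
    (hM : ∀ k, IsRowStochastic (M k)) {γ₀ : ℝ} (hγ₀ : 0 < γ₀)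
    (hgap0 : ∀ h : S → ℝ, γ₀ * lawVariance (μ 0) h ≤ dirichletForm (μ 0) (M 0) h) (hw0 : ∀ k, 0 ≤ w k) (hwhot : 0 < w 0)
    (ht0 : 0 < t) (ht1 : t < 1) (hp : 0 < p) (hdom : ∀ (r : Fin m) (u : S), p * μ (κ r).succ (φ r u) ≤ μ 0 u)
    {c : ℕ} (hc1 : 1 ≤ c) (hc : ∀ k : Fin K, c ≤ (univ.filter (fun r : Fin m => κ r = k)).card)
    {G : ℝ} (hG0 : 0 < G) (hG1 : G * (3 * m) ≤ p * c * t) (hG2 : G * (p + 6 * K) ≤ p * γ₀ * (1 - t) * w 0)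
    (f : (Fin (K + 1) → S) → ℝ) :
    dirichletForm (tensorFun μ) (prodKernel (fun _ : Fin (K + 1) => (1 : ℝ) / (K + 1)) (fun k : Fin (K + 1) => fun _ v : S => μ k v)) f
      ≤ 1 / ((K + 1) * G) * dirichletForm (tensorFun μ) (fun y z : Fin (K + 1) → S =>
          t * ptGraphSwap μ (fun r : Fin m => (((0 : Fin (K + 1)), (κ r).succ) : Fin (K + 1) × Fin (K + 1))) φ y z
            + (1 - t) * prodKernel w M y z) f := by
  have hKpos : (0 : ℝ) < K + 1 := by positivity
  -- the product of exact redraws: `𝓔_{Π*} = (1/(K+1))·Σ_k ½Σ_zΣ_v π̃(z)μ_k(v)(f z − f z^{k←v})²`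
  have hprod2 : dirichletForm (tensorFun μ)
      (prodKernel (fun _ : Fin (K + 1) => (1 : ℝ) / (K + 1)) (fun k : Fin (K + 1) => fun _ v : S => μ k v)) f
      = 1 / (K + 1) * ∑ k : Fin (K + 1), (1 / 2) * ∑ z : Fin (K + 1) → S, ∑ v,
          tensorFun μ z * μ k v * (f z - f (update z k v)) ^ 2 := by
    rw [dirichletForm_prodKernel_eq_sum_coordKernel, mul_sum]
    refine sum_congr rfl fun k _ => ?_
    congr 1
    unfold dirichletForm
    congr 1
    refine sum_congr rfl fun x _ => ?_
    simp_rw [mul_assoc]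
    rw [← mul_sum, sum_coordKernel_mul (fun k : Fin (K + 1) => fun _ v : S => μ k v) k x (fun y => (f x - f y) ^ 2), mul_sum]
  -- the Poincaré inequality of N2 in its Dirichlet-form-comparison guise: `G·Σ_k ½E_k ≤ ... ≤ 𝓔_P` needs `(K+1)` in front
  -- we reuse N2's inequality `G·Var ≤ 𝓔_P`?  No: we need the ENERGY form.  Redo the two budgets.
  have hmpos : (0 : ℝ) < m := Nat.cast_pos.mpr (by omega)
  have hcpos : (0 : ℝ) < c := Nat.cast_pos.mpr (by omega)
  have h1t : 0 < 1 - t := by linarith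
  have hW0 : ∀ z, 0 ≤ tensorFun μ z := fun z => (tensorFun_pos hμ z).le
  set V : ℝ := ∑ z : Fin (K + 1) → S, ∑ v, tensorFun μ z * μ 0 v * (f z - f (update z 0 v)) ^ 2 with hV
  set T : ℝ := ∑ r : Fin m, ∑ x : Fin (K + 1) → S,
    min (tensorFun μ x) (tensorFun μ (edgeFlowSwap (φ r) 0 (κ r).succ x))
      * (f x - f (edgeFlowSwap (φ r) 0 (κ r).succ x)) ^ 2 with hT
  set E : Fin K → ℝ := fun k => ∑ z : Fin (K + 1) → S, ∑ v,
    tensorFun μ z * μ k.succ v * (f z - f (update z k.succ v)) ^ 2 with hE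
  set A : ℝ := dirichletForm (tensorFun μ)
    (ptGraphSwap μ (fun r : Fin m => (((0 : Fin (K + 1)), (κ r).succ) : Fin (K + 1) × Fin (K + 1))) φ) f with hA
  set B : ℝ := dirichletForm (tensorFun μ) (prodKernel w M) f with hB
  have hV0 : 0 ≤ V := sum_nonneg fun z _ => sum_nonneg fun v _ => mul_nonneg (mul_nonneg (hW0 z) (hμ _ _).le) (sq_nonneg _)
  have hT0' : ∀ r : Fin m, 0 ≤ ∑ x : Fin (K + 1) → S, min (tensorFun μ x) (tensorFun μ (edgeFlowSwap (φ r) 0 (κ r).succ x))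
      * (f x - f (edgeFlowSwap (φ r) 0 (κ r).succ x)) ^ 2 :=
    fun r => sum_nonneg fun x _ => mul_nonneg (le_min (hW0 _) (hW0 _)) (sq_nonneg _)
  have hT0 : 0 ≤ T := sum_nonneg fun r _ => hT0' r
  -- cold levels through their entries (N1's fibre lemma)
  have hEk : ∀ k : Fin K, E k ≤ 6 / p * V + 3 / (p * c) * ∑ r ∈ univ.filter (fun r : Fin m => κ r = k),
      ∑ x : Fin (K + 1) → S, min (tensorFun μ x) (tensorFun μ (edgeFlowSwap (φ r) 0 (κ r).succ x))
        * (f x - f (edgeFlowSwap (φ r) 0 (κ r).succ x)) ^ 2 := by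
    intro k
    set ck : ℝ := ((univ.filter (fun r : Fin m => κ r = k)).card : ℝ) with hck
    have hck1 : (c : ℝ) ≤ ck := by rw [hck]; exact_mod_cast hc k
    have hckpos : 0 < ck := lt_of_lt_of_le hcpos hck1
    have hfib := mapStar_coldRedraw_le_fiber hμ hμ1 hp κ φ hdom f k
    set Fk : ℝ := ∑ r ∈ univ.filter (fun r : Fin m => κ r = k), ∑ x : Fin (K + 1) → S,
      min (tensorFun μ x) (tensorFun μ (edgeFlowSwap (φ r) 0 (κ r).succ x))
        * (f x - f (edgeFlowSwap (φ r) 0 (κ r).succ x)) ^ 2 with hFk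
    have hFk0 : 0 ≤ Fk := sum_nonneg fun r _ => hT0' r
    have h1 : ck * E k ≤ ck * (6 / p * V) + 3 / p * Fk := hfib
    have h2 : E k - 6 / p * V ≤ (3 / p * Fk) / ck := by
      rw [le_div_iff₀ hckpos]; nlinarith [h1]
    have h4 : (3 / p * Fk) / ck ≤ (3 / p * Fk) / c := div_le_div_of_nonneg_left (by positivity) hcpos hck1
    have e : (3 / p * Fk) / c = 3 / (p * c) * Fk := by field_simp
    linarith
  have hfiber : ∑ k : Fin K, ∑ r ∈ univ.filter (fun r : Fin m => κ r = k), ∑ x : Fin (K + 1) → S,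
      min (tensorFun μ x) (tensorFun μ (edgeFlowSwap (φ r) 0 (κ r).succ x))
        * (f x - f (edgeFlowSwap (φ r) 0 (κ r).succ x)) ^ 2 = T :=
    Finset.sum_fiberwise univ κ _
  have hcold : ∑ k : Fin K, E k ≤ 6 * K / p * V + 3 / (p * c) * T := by
    calc ∑ k : Fin K, E k ≤ ∑ k : Fin K, (6 / p * V + 3 / (p * c) * ∑ r ∈ univ.filter (fun r : Fin m => κ r = k),
          ∑ x : Fin (K + 1) → S, min (tensorFun μ x) (tensorFun μ (edgeFlowSwap (φ r) 0 (κ r).succ x))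
            * (f x - f (edgeFlowSwap (φ r) 0 (κ r).succ x)) ^ 2) := sum_le_sum fun k _ => hEk k
      _ = 6 * K / p * V + 3 / (p * c) * T := by
          rw [sum_add_distrib, sum_const, card_univ, Fintype.card_fin, nsmul_eq_mul, ← mul_sum, hfiber]; ring
  -- the two budgets against `𝓔_P = tA + (1−t)B`
  have hswap : A = 1 / (2 * m) * T :=
    ptGraph_dirichletForm_swap_eq_min
      (e := fun r : Fin m => (((0 : Fin (K + 1)), (κ r).succ) : Fin (K + 1) × Fin (K + 1))) (φ := φ) hμ
      (fun r => (Fin.succ_ne_zero (κ r)).symm) f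
  set U : ℝ := ∑ x : Fin (K + 1) → S, ∑ v, tensorFun μ x * M 0 (x 0) v * (f x - f (update x 0 v)) ^ 2 with hU
  have hhot : w 0 * (1 / 2 * U) ≤ B := prodKernel_dirichletForm_ge_hot hμ hM hw0 f
  have hVU : V ≤ 1 / γ₀ * U := star_hot_variance_le hμ1 (fun k u => (hμ k u).le) hγ₀ hgap0 f
  have hγ0 : γ₀ ≠ 0 := hγ₀.ne'
  have hsplit : dirichletForm (tensorFun μ) (fun y z : Fin (K + 1) → S =>
      t * ptGraphSwap μ (fun r : Fin m => (((0 : Fin (K + 1)), (κ r).succ) : Fin (K + 1) × Fin (K + 1))) φ y z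
        + (1 - t) * prodKernel w M y z) f = t * A + (1 - t) * B :=
    weightedScheme_dirichletForm t f
  have hp0 : p ≠ 0 := hp.ne'
  have hc0 : (c : ℝ) ≠ 0 := hcpos.ne'
  have hm0 : (m : ℝ) ≠ 0 := hmpos.ne'
  have k2 : G * (3 / (2 * p * c) * T) ≤ t * A := by
    rw [hswap]
    have e1 : G * (3 / (2 * p * c) * T) = (G * (3 * m)) / (p * c) * (T / (2 * m)) := by field_simp
    have e2 : t * (1 / (2 * m) * T) = (p * c * t) / (p * c) * (T / (2 * m)) := by field_simp
    rw [e1, e2]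
    exact mul_le_mul_of_nonneg_right (div_le_div_of_nonneg_right hG1 (by positivity)) (by positivity)
  have k1 : G * ((1 / 2 + 3 * K / p) * V) ≤ (1 - t) * B := by
    have hU' : γ₀ * V ≤ U := by
      have h := mul_le_mul_of_nonneg_left hVU hγ₀.le
      rwa [← mul_assoc, mul_one_div_cancel hγ0, one_mul] at h
    have hB2 : w 0 * U ≤ 2 * B := by linarith [hhot]
    have h5 := mul_le_mul_of_nonneg_left hU' hwhot.le
    have hVB : γ₀ * w 0 * V ≤ 2 * B := by linarith [h5, hB2]
    have h3 : G * (p + 6 * K) * V ≤ p * γ₀ * (1 - t) * w 0 * V := mul_le_mul_of_nonneg_right hG2 hV0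
    have h4 : p * γ₀ * (1 - t) * w 0 * V ≤ p * (1 - t) * (2 * B) := by
      have h := mul_le_mul_of_nonneg_left hVB (mul_nonneg hp.le h1t.le)
      linarith [h]
    have e1 : G * ((1 / 2 + 3 * K / p) * V) = G * (p + 6 * K) * V / (2 * p) := by field_simp; ring
    rw [e1, div_le_iff₀ (by positivity)]
    linarith [h3, h4]
  -- assemble: `(K+1)·G·𝓔_{Π*} = G·(½V + ½ΣE) ≤ G·((½ + 3K/p)V + (3/(2pc))T) ≤ 𝓔_P`
  rw [hprod2, Fin.sum_univ_succ, hsplit]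
  have eE : ∑ k : Fin K, (1 / 2) * ∑ z : Fin (K + 1) → S, ∑ v,
      tensorFun μ z * μ k.succ v * (f z - f (update z k.succ v)) ^ 2 = 1 / 2 * ∑ k : Fin K, E k := by rw [mul_sum]
  rw [eE, ← hV]
  have hmain : G * (1 / 2 * V + 1 / 2 * ∑ k : Fin K, E k) ≤ t * A + (1 - t) * B := by
    have : G * (1 / 2 * V + 1 / 2 * ∑ k : Fin K, E k) ≤ G * ((1 / 2 + 3 * K / p) * V + 3 / (2 * p * c) * T) := by
      refine mul_le_mul_of_nonneg_left ?_ hG0.le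
      have e3 : 3 / (2 * p * c) * T = 1 / 2 * (3 / (p * c) * T) := by
        field_simp
      have e4 : (1 / 2 + 3 * K / p) * V = 1 / 2 * V + 1 / 2 * (6 * K / p * V) := by
        field_simp
        ring
      rw [e3, e4]
      linarith [hcold]
    calc G * (1 / 2 * V + 1 / 2 * ∑ k : Fin K, E k) ≤ G * ((1 / 2 + 3 * K / p) * V + 3 / (2 * p * c) * T) := this
      _ = G * ((1 / 2 + 3 * K / p) * V) + G * (3 / (2 * p * c) * T) := by ring
      _ ≤ (1 - t) * B + t * A := add_le_add k1 k2
      _ = t * A + (1 - t) * B := by ring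
  have hG' : 0 < ((K : ℝ) + 1) * G := by positivity
  have hGne : G ≠ 0 := hG0.ne'
  calc 1 / ((K : ℝ) + 1) * (1 / 2 * V + 1 / 2 * ∑ k : Fin K, E k)
      = (G * (1 / 2 * V + 1 / 2 * ∑ k : Fin K, E k)) / ((K + 1) * G) := by field_simp
    _ ≤ (t * A + (1 - t) * B) / ((K + 1) * G) := div_le_div_of_nonneg_right hmain hG'.le
    _ = 1 / ((K + 1) * G) * (t * A + (1 - t) * B) := by ring

end EntryStar

end Summit.Ventures.LatticeQCDFlow.Scaling

end
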